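import Summits.QuantumFields.BalabanUV.T4Continuum.Support.NE7LandauLinearStraightMap
import Summits.QuantumFields.BalabanUV.T4Continuum.Support.NE7GaugeStepDeviation
import Summits.QuantumFields.BalabanUV.T4Continuum.Support.NE7LandauNewtonRates
import Summits.QuantumFields.BalabanUV.T4Continuum.Support.NE7SliceStepLinear
import HarnessLib

/-!
# NE7LandauNewtonStep — ONE STEP OF ROAD v4's NEWTON SCHEME AT THE TOP (brick T4b, first half): from a unitary periodic `V` with links `a`-close to `1`,
# plaquettes `ε`, and straight datum `q₀` of `log V`, under ONE smallness line `Θ·m₀ ≤ 1` on `m₀ = n₀·2a + n₀²(ε + 32(2a)²) + n₀q₀` (k- and N-uniform), the sequence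
# `u_{i+1} = e^{Φ(N_i)}·u_i`, `E_{i+1} = E_i + (N_i − dΦ(N_i))`, `N_i = log V^{u_i} − E_i` has: `E_i` EXACTLY in the gauge `(1 − P)∂* = 0` entrywise, `‖N_i‖ ≤ (m₀∕n₀)2^{−i}`,
# `‖E_i‖ ≤ 2(K+K′)m₀∕n₀`, links of `V^{u_i}` within `c_r m₀∕n₀` of `1`, `‖u_{i+1} − u_i‖ ≤ 2c_t m₀ 2^{−i}`, `‖E_{i+1} − E_i‖ ≤ (K+K′)(m₀∕n₀)2^{−i}` (`NE7LandauNewtonStep` ∕ `NE7LandauNewtonScheme`)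

Cell `pub-balaban`, lineage `t4-ne7-p1` (CRUX PROVER NE7 #1 = OWNER of row NE7), gen 74; memo `t4/b2b-balaban-t4-ne7-p1-g74/REP-FLAT-ROAD-v4.md` §2–§3.  Assembled BY NAME
from T2′ (`NE7LandauLinearStraightMap.exists_landauMap`: the linear B5-Landau step as a map, order −1 in sup), T3 (`NE7GaugeStepDeviation.gaugeStep_letters`: deviation and
curl letters of a gauge step) and T4a (`NE7LandauNewtonRates`); the sequence is a `Nat.rec` inside the proof (no `def`).  WHAT IS MEASURED: sup of the deviation `N_i`, its
flat curl (gauge COVARIANCE makes it (−2)-size), its straight average (`|Q_k w| ≤ sup|w|`) — never a divergence (memo §2: the divergence of the Newton junk is (−1)-size; this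
is what closes brick E's (−2)-door at the top, desk NE7-TOP-1, and what killed v2.1).  The limit `i → ∞` (T4c) is the exactly gauged representative with `‖log V^{u}‖ ≤ 2(K+K′)m₀∕n₀
= O(δ∕M)` — G7's `hr₀`.
CONTENT ([folklore]; 0 def, 0 sorry; dimension `d + 1`, block side `n₀ ≥ 1`, coarse period `N ≥ 1`).  §1 two small letters (`curlAt_flat_grad`, `norm_mul_sub_one_le_of_unitary`; the curl of a difference is `NE7SliceStepLinear.curlAt_flat_sub`, BY NAME); §2 **`newton_step`** (the analytic core of
the induction `i ↦ i+1`: T2′'s rates + T3's gauge-step letters + T4a's arithmetic; the sequence and its invariant are in `NE7LandauNewtonScheme`).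
HONEST FRAMING (page 1): OUR construction ([B5]'s linear Landau gauge (1.25) iterated at the flat background on the T4 carriers); [B8] Prop. 5 ∕ Thm 2 are about curved
backgrounds with the full (1.36)–(1.39) ladder and are NOT claimed; REP♭ (sup ∧ gradient) NOT proved here (no limit, no gradient yet); (APE) NOT proved; NE7 NOT PRINTED ∕
NOT PROVED (0∕1); spine PROVED 0∕9; rung (B)+1 finite T⁴ — NOT infinite volume, NOT mass gap, NOT BetaPertH, NOT Clay.  PLACEMENT: our lemma, under `Summits/QuantumFields/BalabanUV/`.
Continuum YM on T⁴ ⇐ BetaPertH ∧ nine spine estimates (0/9 proved); BetaPertH ⇐ (D1) ∧ (D4) ∧ CAP+tail; G-an2-4 gates asym, D1 and NE2/3/4.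
-/

set_option autoImplicit false

open scoped BigOperators Matrix Matrix.Norms.L2Operator
open NormedSpace Finset

namespace Summit.QuantumFields.BalabanUV.T4Continuum.NE7LandauNewtonStep

open Literature.MathematicalPhysics.QuantumFieldTheory.Balaban1983to89
open B7Prop1Explicit B7Prop2Explicit MatrixLog
open T4AveragingDeficitWall (IsUnitaryCfg IsSkewDir SmallField vary curlAt)
open T4AveragingDeficitWallBoundary (IsPeriodicCfg)
open AveragingDeficitPeriodicCounting (IsPeriodicDir)
open AveragingDeficitKDatum (isUnitaryCfg_gaugeAct)
open BlockAverageCurrent (smallField_gaugeAct)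
open BlockAveragePushDirSplit (flat)
open NE3EnergyShapes (IsUnitarySite IsPeriodicSite gaugeAct_one)
open NE3SmoothLiftCurl (curlAt_flat_eq)
open NE7SliceStepLinear (curlAt_flat_sub)
open NE3SmoothLiftW (isPeriodicCfg_gaugeAct)
open B5Prop11Plancherel (Tor fine)
open B5Action121 (GradOp)
open B5Block118 (QvOp)
open B5Value126 (PcT)
open B6LowerBound2153Torus (rep)
open NE7GradientCurrency (vary_flat_one_apply)
open NE7SliceStepLetters (norm_curlAt_flat_le_of_plaq)
open NE7LandauLinearStraightMap (exists_landauMap norm_QvOp_mulVec_le)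
open NE7GaugeStepDeviation (gaugeStep_letters)
open NE7LandauNewtonRates (rate_t rate_eta rate_nu rate_gamma rate_r rate_small rate_init)
open Literature.Computability.QuantumComplexity.SolovayKitaev (norm_apply_le_norm)

noncomputable section

variable {d : ℕ} {n : Type*} [Fintype n] [DecidableEq n]

/-! ## §1 Two small letters -/

/-- The flat curl of a lattice gradient vanishes. [folklore] -/
theorem curlAt_flat_grad (σ : Site (d + 1) → Matrix n n ℂ) (x : Site (d + 1)) (μ ν : Fin (d + 1)) :
    curlAt (flat (d := d + 1) (n := n)) (fun y κ => σ (y + e κ) - σ y) x μ ν = 0 := by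
  rw [curlAt_flat_eq]
  simp only [add_right_comm x (e μ) (e ν)]
  abel

/-- `‖g·u − 1‖ ≤ ‖g − 1‖ + ‖u − 1‖` for a unitary `u`. [folklore] -/
theorem norm_mul_sub_one_le_of_unitary [Nonempty n] {u : (Matrix n n ℂ)ˣ} (hu : u ∈ unitaryUnits (Matrix n n ℂ)) (g : Matrix n n ℂ) :
    ‖g * (u : Matrix n n ℂ) - 1‖ ≤ ‖g - 1‖ + ‖(u : Matrix n n ℂ) - 1‖ := by
  letI : CStarAlgebra (Matrix n n ℂ) := {}
  have hu1 : ‖(u : Matrix n n ℂ)‖ = 1 := CStarRing.norm_of_mem_unitary (mem_unitaryUnits.mp hu)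
  calc ‖g * (u : Matrix n n ℂ) - 1‖ = ‖(g - 1) * (u : Matrix n n ℂ) + ((u : Matrix n n ℂ) - 1)‖ := by congr 1; noncomm_ring
    _ ≤ ‖(g - 1) * (u : Matrix n n ℂ)‖ + ‖(u : Matrix n n ℂ) - 1‖ := norm_add_le _ _
    _ ≤ ‖g - 1‖ * ‖(u : Matrix n n ℂ)‖ + ‖(u : Matrix n n ℂ) - 1‖ := by gcongr; exact norm_mul_le _ _
    _ = ‖g - 1‖ + ‖(u : Matrix n n ℂ) - 1‖ := by rw [hu1, mul_one]

/-! ## §2 One Newton step (the analytic core of the induction) -/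

/-- **ONE NEWTON STEP** (dimension `d + 1`; `θ = 2^{−i}`): from a unitary periodic gauge `u` with `log V^{u} = E + N`, `‖E‖ ≤ 2(K+K′)(m₀∕n₀)(1−θ)`, links of `V^{u}`
within `c_r m₀∕n₀`, `‖N‖ ≤ (m₀∕n₀)θ`, `‖curl₁ N‖ ≤ (m₀∕n₀²)θ`, and the linear step's gauge function `σ` for `N` (skew, periodic, with T2′'s two estimates at the straight
datum `(m₀∕n₀)θ`), under the smallness consequences of `Θ m₀ ≤ 1`: the gauge `e^{σ}·u` is unitary periodic, `‖σ‖ ≤ c_t m₀ θ`, `‖N − dσ‖ ≤ (K+K′)(m₀∕n₀)θ`,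
`‖E + (N − dσ)‖ ≤ 2(K+K′)(m₀∕n₀)(1 − θ∕2)`, the links of `V^{e^{σ}u}` stay within `c_r m₀∕n₀`, and the new deviation `N′ = log V^{e^{σ}u} − (E + (N − dσ))` has
`‖N′‖ ≤ (m₀∕n₀)(θ∕2)`, `‖curl₁ N′‖ ≤ (m₀∕n₀²)(θ∕2)`. [folklore] -/
theorem newton_step [Nonempty n] {n₀ N : ℕ} [NeZero n₀] [NeZero N] {V : Site (d + 1) → Fin (d + 1) → (Matrix n n ℂ)ˣ} {ε : ℝ}
    (hVu : IsUnitaryCfg V) (hVP : IsPeriodicCfg V ((n₀ * N : ℕ) : ℤ)) (hε : 0 ≤ ε) (hVε : SmallField V ε)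
    {K K' m₀ ct cδ cr θ : ℝ} (hK : 0 ≤ K) (hK' : 0 ≤ K') (hm0 : 0 ≤ m₀) (hm1 : m₀ ≤ 1) (hθ0 : 0 ≤ θ) (hθ1 : θ ≤ 1)
    (hct : ct = ((d + 1 : ℕ) : ℝ) * (Fintype.card n + K + K')) (hcδ : cδ = 1 + K + K') (hcr : cr = 4 * (K + K') + 1 + 8 * (ct + cδ) * cδ)
    (hcr80 : cr * m₀ ≤ 1 / 80) (hct40 : ct * m₀ ≤ 1 / 40) (hcδ40 : cδ * m₀ ≤ 1 / 40) (hline1 : 8 * (ct + cδ) * (2 * cr + cδ) * m₀ ≤ 1)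
    (hline2 : 2 * (4 * ct + 128 * cr * (cδ + 1 / 2)) * m₀ ≤ 1) (hεx : ε ≤ m₀ / (n₀ : ℝ) ^ 2)
    {u : Site (d + 1) → (Matrix n n ℂ)ˣ} {E Nn : Site (d + 1) → Fin (d + 1) → Matrix n n ℂ} {σ : Site (d + 1) → Matrix n n ℂ}
    (hu : IsUnitarySite u) (huP : IsPeriodicSite u ((n₀ * N : ℕ) : ℤ))
    (hNdef : ∀ (y : Site (d + 1)) (κ : Fin (d + 1)), Nn y κ = mlog ((gaugeAct u V y κ : (Matrix n n ℂ)ˣ) : Matrix n n ℂ) - E y κ)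
    (hEn : ∀ (y : Site (d + 1)) (κ : Fin (d + 1)), ‖E y κ‖ ≤ 2 * (K + K') * (m₀ / n₀) * (1 - θ))
    (hWr : ∀ (y : Site (d + 1)) (κ : Fin (d + 1)), ‖((gaugeAct u V y κ : (Matrix n n ℂ)ˣ) : Matrix n n ℂ) - 1‖ ≤ cr * (m₀ / n₀))
    (hNn : ∀ (y : Site (d + 1)) (κ : Fin (d + 1)), ‖Nn y κ‖ ≤ m₀ / n₀ * θ)
    (hσP : ∀ (y : Site (d + 1)) (ι : Fin (d + 1)), σ (y + ((n₀ * N : ℕ) : ℤ) • e ι) = σ y) (hσs : ∀ y : Site (d + 1), σ y ∈ skewAdjoint (Matrix n n ℂ))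
    (hNσ : ∀ (y : Site (d + 1)) (κ : Fin (d + 1)), ‖Nn y κ - (σ (y + e κ) - σ y)‖ ≤ K * (n₀ : ℝ) * (m₀ / (n₀ : ℝ) ^ 2 * θ) + K' * (m₀ / n₀ * θ))
    (hσn : ∀ y : Site (d + 1), ‖σ y‖ ≤ ((d + 1 : ℕ) : ℝ) * ((n₀ : ℝ) - 1) * (Fintype.card n * (m₀ / n₀ * θ) + K * (n₀ : ℝ) * (m₀ / (n₀ : ℝ) ^ 2 * θ) + K' * (m₀ / n₀ * θ))) :
    IsUnitarySite (fun y => expUnit (σ y) * u y) ∧ IsPeriodicSite (fun y => expUnit (σ y) * u y) ((n₀ * N : ℕ) : ℤ) ∧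
    (∀ y : Site (d + 1), ‖σ y‖ ≤ ct * m₀ * θ) ∧
    (∀ (y : Site (d + 1)) (κ : Fin (d + 1)), ‖Nn y κ - (σ (y + e κ) - σ y)‖ ≤ (K + K') * (m₀ / n₀ * θ)) ∧
    (∀ (y : Site (d + 1)) (κ : Fin (d + 1)), ‖E y κ + (Nn y κ - (σ (y + e κ) - σ y))‖ ≤ 2 * (K + K') * (m₀ / n₀) * (1 - θ / 2)) ∧
    (∀ (y : Site (d + 1)) (κ : Fin (d + 1)), ‖((gaugeAct (fun y => expUnit (σ y) * u y) V y κ : (Matrix n n ℂ)ˣ) : Matrix n n ℂ) - 1‖ ≤ cr * (m₀ / n₀)) ∧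
    (∀ (y : Site (d + 1)) (κ : Fin (d + 1)),
      ‖mlog ((gaugeAct (fun y => expUnit (σ y) * u y) V y κ : (Matrix n n ℂ)ˣ) : Matrix n n ℂ) - (E y κ + (Nn y κ - (σ (y + e κ) - σ y)))‖ ≤ m₀ / n₀ * (θ / 2)) ∧
    (∀ (z : Site (d + 1)) (μ ν : Fin (d + 1)),
      ‖curlAt (flat (d := d + 1) (n := n))
          (fun y κ => mlog ((gaugeAct (fun y => expUnit (σ y) * u y) V y κ : (Matrix n n ℂ)ˣ) : Matrix n n ℂ) - (E y κ + (Nn y κ - (σ (y + e κ) - σ y)))) z μ ν‖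
        ≤ m₀ / (n₀ : ℝ) ^ 2 * (θ / 2)) := by
  letI : CStarAlgebra (Matrix n n ℂ) := {}
  have hn1 : (1 : ℝ) ≤ n₀ := by exact_mod_cast Nat.one_le_iff_ne_zero.mpr (NeZero.ne n₀)
  have hn0 : (0 : ℝ) < n₀ := by linarith
  have hD0 : (0 : ℝ) ≤ ((d + 1 : ℕ) : ℝ) := Nat.cast_nonneg _
  have hcn0 : (0 : ℝ) ≤ Fintype.card n := Nat.cast_nonneg _
  have hct0 : 0 ≤ ct := by rw [hct]; positivity
  have hcδ0 : 0 ≤ cδ := by rw [hcδ]; positivity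
  have hcr0 : 0 ≤ cr := by rw [hcr]; positivity
  have hx0 : 0 ≤ m₀ / n₀ := by positivity
  have hxm : m₀ / n₀ ≤ m₀ := div_le_self hm0 hn1
  have hxθ0 : 0 ≤ m₀ / n₀ * θ := mul_nonneg hx0 hθ0
  -- `W = V^{u}`
  have hWu : IsUnitaryCfg (gaugeAct u V) := isUnitaryCfg_gaugeAct hu hVu
  have hWP : IsPeriodicCfg (gaugeAct u V) ((n₀ * N : ℕ) : ℤ) := isPeriodicCfg_gaugeAct huP hVP
  have hWε : SmallField (gaugeAct u V) ε := smallField_gaugeAct hu hVε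
  -- the rates of the linear step
  have ht : ∀ y, ‖σ y‖ ≤ ct * m₀ * θ := fun y => by
    refine (hσn y).trans ?_
    rw [hct]
    exact rate_t hD0 hcn0 hK hK' hn1 hm0 hθ0 le_rfl le_rfl le_rfl
  obtain ⟨hKK, hδδ⟩ := rate_eta (K := K) (K' := K') (n₀ := (n₀ : ℝ)) (m₀ := m₀) (θ := θ) hK hK' hn1
    (ν := m₀ / n₀ * θ) (γ := m₀ / (n₀ : ℝ) ^ 2 * θ) (q := m₀ / n₀ * θ) le_rfl le_rfl le_rfl
  have hηb : ∀ (y : Site (d + 1)) (κ : Fin (d + 1)), ‖Nn y κ - (σ (y + e κ) - σ y)‖ ≤ (K + K') * (m₀ / n₀ * θ) := fun y κ =>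
    (hNσ y κ).trans hKK
  have hdσ : ∀ (y : Site (d + 1)) (κ : Fin (d + 1)), ‖σ (y + e κ) - σ y‖ ≤ cδ * (m₀ / n₀ * θ) := by
    intro y κ
    rw [hcδ]
    calc ‖σ (y + e κ) - σ y‖ = ‖Nn y κ - (Nn y κ - (σ (y + e κ) - σ y))‖ := by rw [sub_sub_cancel]
      _ ≤ ‖Nn y κ‖ + ‖Nn y κ - (σ (y + e κ) - σ y)‖ := norm_sub_le _ _
      _ ≤ m₀ / n₀ * θ + (K * (n₀ : ℝ) * (m₀ / (n₀ : ℝ) ^ 2 * θ) + K' * (m₀ / n₀ * θ)) := add_le_add (hNn y κ) (hNσ y κ)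
      _ ≤ (1 + K + K') * (m₀ / n₀ * θ) := hδδ
  -- `log W − dσ = E + (N − dσ)`
  have hlogW : ∀ (y : Site (d + 1)) (κ : Fin (d + 1)), mlog ((gaugeAct u V y κ : (Matrix n n ℂ)ˣ) : Matrix n n ℂ) = E y κ + Nn y κ := by
    intro y κ; rw [hNdef]; abel
  have hKK0 : 0 ≤ (K + K') * (m₀ / n₀ * θ) := mul_nonneg (add_nonneg hK hK') hxθ0
  have he' : 2 * (K + K') * (m₀ / n₀) * (1 - θ) + (K + K') * (m₀ / n₀ * θ) ≤ 2 * (K + K') * (m₀ / n₀) := by nlinarith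
  have hE'n : ∀ (y : Site (d + 1)) (κ : Fin (d + 1)),
      ‖E y κ + (Nn y κ - (σ (y + e κ) - σ y))‖ ≤ 2 * (K + K') * (m₀ / n₀) * (1 - θ) + (K + K') * (m₀ / n₀ * θ) := fun y κ =>
    (norm_add_le _ _).trans (add_le_add (hEn y κ) (hηb y κ))
  have hρ₁ : ∀ (y : Site (d + 1)) (κ : Fin (d + 1)),
      ‖mlog ((gaugeAct u V y κ : (Matrix n n ℂ)ˣ) : Matrix n n ℂ) - (σ (y + e κ) - σ y)‖
        ≤ 2 * (K + K') * (m₀ / n₀) * (1 - θ) + (K + K') * (m₀ / n₀ * θ) := by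
    intro y κ
    have h : mlog ((gaugeAct u V y κ : (Matrix n n ℂ)ˣ) : Matrix n n ℂ) - (σ (y + e κ) - σ y) = E y κ + (Nn y κ - (σ (y + e κ) - σ y)) := by
      rw [hlogW]; abel
    exact (congrArg (fun w : Matrix n n ℂ => ‖w‖) h).trans_le (hE'n y κ)
  -- the regime of T3
  have hr80 : cr * (m₀ / n₀) ≤ 1 / 80 := (mul_le_mul_of_nonneg_left hxm hcr0).trans hcr80
  have ht40 : ct * m₀ * θ ≤ 1 / 40 := (mul_le_of_le_one_right (mul_nonneg hct0 hm0) hθ1).trans hct40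
  have hδ40 : cδ * (m₀ / n₀ * θ) ≤ 1 / 40 := by
    have h1 : m₀ / n₀ * θ ≤ m₀ := by
      calc m₀ / n₀ * θ ≤ m₀ / n₀ * 1 := mul_le_mul_of_nonneg_left hθ1 hx0
        _ ≤ m₀ := by rw [mul_one]; exact hxm
    exact (mul_le_mul_of_nonneg_left h1 hcδ0).trans hcδ40
  have hδ0' : 0 ≤ cδ * (m₀ / n₀ * θ) := mul_nonneg hcδ0 hxθ0
  have hr' : 2 * (2 * (K + K') * (m₀ / n₀) * (1 - θ) + (K + K') * (m₀ / n₀ * θ))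
      + 8 * (ct * m₀ * θ + cδ * (m₀ / n₀ * θ)) * (cδ * (m₀ / n₀ * θ)) ≤ cr * (m₀ / n₀) := by
    rw [hcr]
    exact rate_r hn1 hm0 hm1 hθ0 hθ1 hct0 hcδ0 hδ0' le_rfl le_rfl he'
  have hcrx0 : 0 ≤ cr * (m₀ / n₀) := mul_nonneg hcr0 hx0
  obtain ⟨hgU, hgP, -, -, -, hlink', hdev, hcurl'⟩ :=
    gaugeStep_letters hWu hWP hε hWε hWr hr80 hσs hσP ht hdσ hρ₁ ht40 hδ40 (hr'.trans hr80) (ρ := 4 * (cr * (m₀ / n₀))) (by linarith) (by linarith)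
  -- the new configuration is `(V^{u})^{e^{σ}}`
  have hfac : gaugeAct (fun y => expUnit (σ y) * u y) V = gaugeAct (fun y => expUnit (σ y)) (gaugeAct u V) :=
    B8Eq115GaugeFixing.gaugeAct_mul (fun y => expUnit (σ y)) u V
  have hν' : 4 * (ct * m₀ * θ + cδ * (m₀ / n₀ * θ)) * (2 * (cr * (m₀ / n₀)) + cδ * (m₀ / n₀ * θ)) ≤ m₀ / n₀ * (θ / 2) :=
    rate_nu hn1 hm0 hθ0 hθ1 hct0 hcδ0 hδ0' hcrx0 le_rfl le_rfl le_rfl hline1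
  refine ⟨fun y => (unitaryUnits _).mul_mem (hgU y) (hu y), fun y ι => by simp only [hgP y ι, huP y ι], ht, hηb,
    fun y κ => (hE'n y κ).trans (le_of_eq (by ring)), fun y κ => ?_, fun y κ => ?_, fun z μ ν => ?_⟩
  · -- links
    have h := hlink' y κ
    rw [← hfac] at h
    exact h.trans hr'
  · -- the new deviation
    have h := hdev y κ
    rw [← hfac, hlogW, show E y κ + Nn y κ - (σ (y + e κ) - σ y) = E y κ + (Nn y κ - (σ (y + e κ) - σ y)) by abel] at h
    exact h.trans hν'
  · -- its flat curl
    have hfun : (fun y κ => mlog ((gaugeAct (fun y => expUnit (σ y) * u y) V y κ : (Matrix n n ℂ)ˣ) : Matrix n n ℂ) - (E y κ + (Nn y κ - (σ (y + e κ) - σ y))))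
        = fun y κ => mlog ((gaugeAct (fun y => expUnit (σ y)) (gaugeAct u V) y κ : (Matrix n n ℂ)ˣ) : Matrix n n ℂ)
          - (mlog ((gaugeAct u V y κ : (Matrix n n ℂ)ˣ) : Matrix n n ℂ) - (σ (y + e κ) - σ y)) := by
      funext y κ; rw [hfac, hlogW]; abel
    have hcurlEq : curlAt (flat (d := d + 1) (n := n))
          (fun y κ => mlog ((gaugeAct (fun y => expUnit (σ y) * u y) V y κ : (Matrix n n ℂ)ˣ) : Matrix n n ℂ) - (E y κ + (Nn y κ - (σ (y + e κ) - σ y)))) z μ ν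
        = curlAt (flat (d := d + 1) (n := n)) (fun y κ => mlog ((gaugeAct (fun y => expUnit (σ y)) (gaugeAct u V) y κ : (Matrix n n ℂ)ˣ) : Matrix n n ℂ)) z μ ν
          - curlAt (flat (d := d + 1) (n := n)) (fun y κ => mlog ((gaugeAct u V y κ : (Matrix n n ℂ)ˣ) : Matrix n n ℂ)) z μ ν := by
      rw [hfun, curlAt_flat_sub, curlAt_flat_sub, curlAt_flat_grad, sub_zero]
    have hν'0 : 0 ≤ 4 * (ct * m₀ * θ + cδ * (m₀ / n₀ * θ)) * (2 * (cr * (m₀ / n₀)) + cδ * (m₀ / n₀ * θ)) :=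
      mul_nonneg (mul_nonneg (by norm_num) (add_nonneg (mul_nonneg (mul_nonneg hct0 hm0) hθ0) hδ0'))
        (add_nonneg (mul_nonneg (by norm_num) hcrx0) hδ0')
    have hgam := rate_gamma hn1 hm0 hθ0 hct0 hcr0 (δ := cδ * (m₀ / n₀ * θ)) hδ0'
      (ν' := 4 * (ct * m₀ * θ + cδ * (m₀ / n₀ * θ)) * (2 * (cr * (m₀ / n₀)) + cδ * (m₀ / n₀ * θ))) hν'0 hε
      (ρ := 4 * (cr * (m₀ / n₀))) (mul_nonneg (by norm_num) hcrx0)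
      le_rfl le_rfl hν' hεx (le_of_eq (by ring)) (by linarith [hr80]) hline2
    calc _ = _ := congrArg (fun w : Matrix n n ℂ => ‖w‖) hcurlEq
      _ ≤ _ := hcurl' z μ ν
      _ ≤ m₀ / (n₀ : ℝ) ^ 2 * (θ / 2) := hgam

end

end Summit.QuantumFields.BalabanUV.T4Continuum.NE7LandauNewtonStep
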